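import Summits.HubbardSuperconductivity.HubbardSuperconductivity.Theorems.AposterioriCapRgDefs
import Literature.MathematicalPhysics.QuantumLattice.XYOrderDischarges
import Literature.MathematicalPhysics.QuantumLattice.GroundStateSourceBounds

/-!
# `XYOrderOpennessLargeSpin`, line `feynman-sector-gap`: the XY double commutator
# (`stub_doubleCommutatorXY`)

Crux item stmt-HubbardSuperconductivity-13895 (route `AposterioriCapRg`), vocabulary of
`Theorems/AposterioriCapRgDefs.lean`. For the in-plane Fourier modes `A = Ŝ^α_q = Σ_y c_y S^α_y`
(`α = 0, 1`, `|c_y| = 1`) of the spin-`n/2` torus `(ℤ/Lℤ)²`, `L ≥ 3`, the XY Hamiltonian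
`X = xyTorus 2 L n = -Σ_{bonds b} (b⁰ + b¹)` and ANY Hermitian `H'` (whose tracial ground state `ω'`
plays the role of an arbitrary state):

`Re ω'([Aᴴ, [X, A]]) ≤ 4 n² L²`   (`doubleComm A X = [Aᴴ, [X, A]]`).

Proof (Kennedy–Lieb–Shastry, J. Stat. Phys. 53 (1988) 1019, eq. (13), made state-independent):
* `|Re ω'(D)| ≤ ‖D‖` (`abs_re_groundStateFunctional_le_norm`, L²-operator norm);
* bilinearity: `D = -Σ_x Σ_b Σ_y conj(c_x) c_y [S^α_x, [h_b, S^α_y]]`, so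
  `‖D‖ ≤ Σ_b Σ_x Σ_y ‖[S^α_x, [h_b, S^α_y]]‖`;
* for a bond term `P Q = S^β_u S^β_v` the Leibniz rule gives
  `[R_x, [PQ, R_y]] = [R_x,P][Q,R_y] + P[R_x,[Q,R_y]] + [R_x,[P,R_y]]Q + [P,R_y][R_x,Q]`;
  single commutators `[S^a_x, S^b_z]` vanish unless `x = z` (locality) and are then, BY THE su(2)
  RELATIONS `[Sᵃ, Sᵇ] = i ε_{abc} Sᶜ` (`spin_commutation_holds`), unit multiples of a spin
  component, of norm `≤ S = n/2` (`(Sᵞ)² ≤ S²`, `posSemidef_sq_smul_one_sub_siteSpin_sq`, and the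
  C⋆-identity); hence `Σ_x ‖[S^a_x, S^b_z]‖ ≤ S`, `Σ_{x,y} ‖[S^a_x,[S^b_z,S^d_y]]‖ ≤ S`, and the
  double sum over `x, y` of each bond term is `≤ 4 S² = n²` (a naive norm bound would give `n⁴`);
* two components per bond and `#bonds = 2L²` (`sum_pairs_eq_sum_edgeFinset`) give `4 n² L²`.
-/

noncomputable section

namespace Summit.HubbardSuperconductivity.HubbardSuperconductivity.Theorems.XYOrderOpennessLargeSpin

set_option linter.dupNamespace false -- summit = problem name (single-conjunct summit), D-0017

open Matrix Complex Finset
open scoped ComplexOrder Matrix.Norms.L2Operator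
open Literature.MathematicalPhysics.QuantumLattice Literature.Probability.LatticeModels

/-! ### The ring commutator `⁅A, B⁆ = AB - BA` of complex matrices: bilinearity, Leibniz -/

section RingBracket

variable {m : Type*} [Fintype m]

/-- `⁅A + B, C⁆ = ⁅A, C⁆ + ⁅B, C⁆`. [folklore] -/
private theorem mx_add_lie (A B C : Matrix m m ℂ) : ⁅A + B, C⁆ = ⁅A, C⁆ + ⁅B, C⁆ := by
  simp only [Ring.lie_def, add_mul, mul_add]; abel

/-- `⁅A, B + C⁆ = ⁅A, B⁆ + ⁅A, C⁆`. [folklore] -/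
private theorem mx_lie_add (A B C : Matrix m m ℂ) : ⁅A, B + C⁆ = ⁅A, B⁆ + ⁅A, C⁆ := by
  simp only [Ring.lie_def, add_mul, mul_add]; abel

/-- `⁅c • A, B⁆ = c • ⁅A, B⁆`. [folklore] -/
private theorem mx_smul_lie (c : ℂ) (A B : Matrix m m ℂ) : ⁅c • A, B⁆ = c • ⁅A, B⁆ := by
  rw [Ring.lie_def, Ring.lie_def, smul_mul_assoc, mul_smul_comm, smul_sub]

/-- `⁅A, c • B⁆ = c • ⁅A, B⁆`. [folklore] -/
private theorem mx_lie_smul (c : ℂ) (A B : Matrix m m ℂ) : ⁅A, c • B⁆ = c • ⁅A, B⁆ := by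
  rw [Ring.lie_def, Ring.lie_def, mul_smul_comm, smul_mul_assoc, smul_sub]

/-- `⁅Σ_i A_i, C⁆ = Σ_i ⁅A_i, C⁆`. [folklore] -/
private theorem mx_sum_lie {ι : Type*} (s : Finset ι) (A : ι → Matrix m m ℂ) (C : Matrix m m ℂ) :
    ⁅∑ i ∈ s, A i, C⁆ = ∑ i ∈ s, ⁅A i, C⁆ := by
  simp only [Ring.lie_def, Finset.sum_mul, Finset.mul_sum, Finset.sum_sub_distrib]

/-- `⁅C, Σ_i A_i⁆ = Σ_i ⁅C, A_i⁆`. [folklore] -/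
private theorem mx_lie_sum {ι : Type*} (s : Finset ι) (A : ι → Matrix m m ℂ) (C : Matrix m m ℂ) :
    ⁅C, ∑ i ∈ s, A i⁆ = ∑ i ∈ s, ⁅C, A i⁆ := by
  simp only [Ring.lie_def, Finset.sum_mul, Finset.mul_sum, Finset.sum_sub_distrib]

/-- **Leibniz expansion of a double commutator with a product**:
`⁅R, ⁅PQ, R'⁆⁆ = ⁅R,P⁆⁅Q,R'⁆ + P⁅R,⁅Q,R'⁆⁆ + ⁅R,⁅P,R'⁆⁆Q + ⁅P,R'⁆⁅R,Q⁆`. [folklore] -/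
private theorem mx_lie_lie_mul (R P Q R' : Matrix m m ℂ) :
    ⁅R, ⁅P * Q, R'⁆⁆ =
      ⁅R, P⁆ * ⁅Q, R'⁆ + P * ⁅R, ⁅Q, R'⁆⁆ + ⁅R, ⁅P, R'⁆⁆ * Q + ⁅P, R'⁆ * ⁅R, Q⁆ := by
  simp only [Ring.lie_def, mul_sub, sub_mul, mul_assoc]
  abel

end RingBracket

/-! ### Spin algebra: norms and on-site commutators -/

section SpinAlgebra

open scoped MatrixOrder

variable {Λ : Type*} [Fintype Λ] [DecidableEq Λ]

/-- `‖S^γ_x‖ ≤ S = n/2` (L²-operator norm): `0 ≤ (S^γ_x)ᴴ S^γ_x = (S^γ_x)² ≤ S²·1` in the Loewner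
order (`posSemidef_sq_smul_one_sub_siteSpin_sq`), the norm is monotone on the positive cone of the
matrix C⋆-algebra, and `‖Tᴴ T‖ = ‖T‖²`. [folklore] -/
private theorem norm_siteSpin_le (n : ℕ) (x : Λ) (γ : Fin 3) :
    ‖(siteSpin n x γ : Op Λ (n + 1))‖ ≤ (n : ℝ) / 2 := by
  letI : CStarAlgebra (Op Λ (n + 1)) := {}
  set T : Op Λ (n + 1) := siteSpin n x γ
  have hH : Tᴴ = T := (siteSpin_isHermitian n x γ).eq
  have h0 : (0 : Op Λ (n + 1)) ≤ T * T := by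
    rw [Matrix.nonneg_iff_posSemidef]
    nth_rewrite 1 [← hH]
    exact posSemidef_conjTranspose_mul_self T
  have h1 : T * T ≤ (((n : ℂ) / 2) ^ 2) • (1 : Op Λ (n + 1)) := by
    rw [Matrix.le_iff]
    exact posSemidef_sq_smul_one_sub_siteSpin_sq n x γ
  have h2 : ‖T * T‖ ≤ ‖(((n : ℂ) / 2) ^ 2) • (1 : Op Λ (n + 1))‖ :=
    CStarAlgebra.norm_le_norm_of_nonneg_of_le h0 h1
  have h3 : ‖T * T‖ = ‖T‖ * ‖T‖ := by
    nth_rewrite 1 [← hH]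
    exact Matrix.l2_opNorm_conjTranspose_mul_self T
  have h4 : ‖(((n : ℂ) / 2) ^ 2) • (1 : Op Λ (n + 1))‖ = ((n : ℝ) / 2) ^ 2 := by
    rw [norm_smul, CStarRing.norm_one, mul_one,
      show ((n : ℂ) / 2) ^ 2 = ((((n : ℝ) / 2) ^ 2 : ℝ) : ℂ) by push_cast; ring, Complex.norm_real,
      Real.norm_of_nonneg (by positivity)]
  rw [h3, h4] at h2
  have hS : (0 : ℝ) ≤ (n : ℝ) / 2 := by positivity
  nlinarith [norm_nonneg T, h2, hS]

/-- The su(2) relations in structural form: every commutator of two spin components is a scalar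
multiple of modulus `≤ 1` of a spin component (`[Sᵃ, Sᵃ] = 0`, `[Sᵃ, Sᵃ⁺¹] = i Sᵃ⁺²`,
`[Sᵃ, Sᵃ⁺²] = -i Sᵃ⁺¹`; Tasaki (2020) §2.1, eq. (2.1.1)). [folklore] -/
private theorem lie_spinVec_eq_smul (n : ℕ) (a b : Fin 3) :
    ∃ (γ : Fin 3) (c : ℂ), ‖c‖ ≤ 1 ∧ ⁅spinVec n a, spinVec n b⁆ = c • spinVec n γ := by
  have hcyc : ∀ a : Fin 3, ⁅spinVec n a, spinVec n (a + 1)⁆ = I • spinVec n (a + 2) :=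
    spin_commutation_holds n
  have e1 : ∀ a : Fin 3, a + 2 + 1 = a := by decide
  have e2 : ∀ a : Fin 3, a + 2 + 2 = a + 1 := by decide
  obtain rfl | rfl | rfl : b = a ∨ b = a + 1 ∨ b = a + 2 := by revert a b; decide
  · exact ⟨b, 0, by simp, by rw [Ring.lie_def, sub_self, zero_smul]⟩
  · exact ⟨a + 2, I, by simp, hcyc a⟩
  · refine ⟨a + 1, -I, by simp, ?_⟩
    have h := hcyc (a + 2)
    rw [e1, e2] at h
    rw [Ring.lie_def, ← neg_sub, ← Ring.lie_def, h, neg_smul]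

/-- On-site commutators: `[S^a_x, S^b_x] = 𝟙 ⊗ [S^a, S^b] ⊗ 𝟙`. [folklore] -/
private theorem lie_siteSpin_same (n : ℕ) (x : Λ) (a b : Fin 3) :
    ⁅(siteSpin n x a : Op Λ (n + 1)), siteSpin n x b⁆ = onSite x ⁅spinVec n a, spinVec n b⁆ := by
  -- adapted from `lie_siteSpin_same` (Literature/.../XYOrderInfraredProofs.lean)
  rw [Ring.lie_def, Ring.lie_def, siteSpin, siteSpin, onSite_mul, onSite_mul, onSite_sub']

/-- `[S^a_x, S^b_x] = c • S^γ_x` with `‖c‖ ≤ 1` (su(2) at one site). [folklore] -/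
private theorem lie_siteSpin_eq_smul (n : ℕ) (x : Λ) (a b : Fin 3) :
    ∃ (γ : Fin 3) (c : ℂ), ‖c‖ ≤ 1 ∧
      ⁅(siteSpin n x a : Op Λ (n + 1)), siteSpin n x b⁆ = c • siteSpin n x γ := by
  obtain ⟨γ, c, hc, h⟩ := lie_spinVec_eq_smul n a b
  refine ⟨γ, c, hc, ?_⟩
  rw [lie_siteSpin_same, h, onSite_smul']
  rfl

/-- Locality: `[S^a_x, S^b_z] = 0` for `x ≠ z`. [folklore] -/
private theorem lie_siteSpin_of_ne (n : ℕ) {x z : Λ} (hxz : x ≠ z) (a b : Fin 3) :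
    ⁅(siteSpin n x a : Op Λ (n + 1)), siteSpin n z b⁆ = 0 :=
  (siteSpin_commute_of_ne_holds n hxz a b).lie_eq

/-- `‖[S^a_x, S^b_x]‖ ≤ n/2`. [folklore] -/
private theorem norm_lie_siteSpin_le (n : ℕ) (x : Λ) (a b : Fin 3) :
    ‖⁅(siteSpin n x a : Op Λ (n + 1)), siteSpin n x b⁆‖ ≤ (n : ℝ) / 2 := by
  obtain ⟨γ, c, hc, h⟩ := lie_siteSpin_eq_smul n x a b
  rw [h, norm_smul]
  calc ‖c‖ * ‖(siteSpin n x γ : Op Λ (n + 1))‖ ≤ 1 * ((n : ℝ) / 2) :=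
        mul_le_mul hc (norm_siteSpin_le n x γ) (norm_nonneg _) zero_le_one
    _ = (n : ℝ) / 2 := one_mul _

/-- `Σ_x ‖[S^a_x, S^b_z]‖ ≤ n/2` (only `x = z` contributes). [folklore] -/
private theorem sum_norm_lie_siteSpin_le (n : ℕ) (z : Λ) (a b : Fin 3) :
    ∑ x : Λ, ‖⁅(siteSpin n x a : Op Λ (n + 1)), siteSpin n z b⁆‖ ≤ (n : ℝ) / 2 := by
  rw [Finset.sum_eq_single z]
  · exact norm_lie_siteSpin_le n z a b
  · intro x _ hxz
    rw [lie_siteSpin_of_ne n hxz, norm_zero]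
  · exact fun h => (h (Finset.mem_univ z)).elim

/-- `Σ_y ‖[S^b_z, S^d_y]‖ ≤ n/2` (only `y = z` contributes). [folklore] -/
private theorem sum_norm_lie_siteSpin_le' (n : ℕ) (z : Λ) (b d : Fin 3) :
    ∑ y : Λ, ‖⁅(siteSpin n z b : Op Λ (n + 1)), siteSpin n y d⁆‖ ≤ (n : ℝ) / 2 := by
  rw [Finset.sum_eq_single z]
  · exact norm_lie_siteSpin_le n z b d
  · intro y _ hyz
    rw [lie_siteSpin_of_ne n (Ne.symm hyz), norm_zero]
  · exact fun h => (h (Finset.mem_univ z)).elim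

/-- `Σ_x Σ_y ‖[S^a_x, [S^b_z, S^d_y]]‖ ≤ n/2`: only `x = y = z` contributes, and the inner
commutator is again a multiple of modulus `≤ 1` of a spin component (su(2) used twice).
[folklore] -/
private theorem sum_sum_norm_lie_lie_siteSpin_le (n : ℕ) (z : Λ) (a b d : Fin 3) :
    ∑ x : Λ, ∑ y : Λ, ‖⁅(siteSpin n x a : Op Λ (n + 1)), ⁅siteSpin n z b, siteSpin n y d⁆⁆‖ ≤
      (n : ℝ) / 2 := by
  obtain ⟨γ, c, hc, h⟩ := lie_siteSpin_eq_smul n z b d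
  have hy : ∀ x : Λ,
      ∑ y : Λ, ‖⁅(siteSpin n x a : Op Λ (n + 1)), ⁅siteSpin n z b, siteSpin n y d⁆⁆‖ =
      ‖⁅(siteSpin n x a : Op Λ (n + 1)), ⁅siteSpin n z b, siteSpin n z d⁆⁆‖ := by
    intro x
    rw [Finset.sum_eq_single z]
    · intro y _ hyz
      rw [lie_siteSpin_of_ne n (Ne.symm hyz)]
      simp [Ring.lie_def]
    · exact fun h => (h (Finset.mem_univ z)).elim
  calc ∑ x : Λ, ∑ y : Λ, ‖⁅(siteSpin n x a : Op Λ (n + 1)), ⁅siteSpin n z b, siteSpin n y d⁆⁆‖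
      = ‖c‖ * ∑ x : Λ, ‖⁅(siteSpin n x a : Op Λ (n + 1)), siteSpin n z γ⁆‖ := by
        rw [Finset.mul_sum]
        refine Finset.sum_congr rfl fun x _ => ?_
        rw [hy, h, mx_lie_smul, norm_smul]
    _ ≤ 1 * ((n : ℝ) / 2) :=
        mul_le_mul hc (sum_norm_lie_siteSpin_le n z a γ)
          (Finset.sum_nonneg fun _ _ => norm_nonneg _) zero_le_one
    _ = (n : ℝ) / 2 := one_mul _

/-! ### The double sum over a bond term -/

/-- **The core estimate** (su(2) + locality): for a product `P Q = S^b_u S^{b'}_v` of two spins,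
`Σ_x Σ_y ‖[S^a_x, [P Q, S^d_y]]‖ ≤ 4 S² = n²`, through the Leibniz expansion
`[R_x,[PQ,R_y]] = [R_x,P][Q,R_y] + P[R_x,[Q,R_y]] + [R_x,[P,R_y]]Q + [P,R_y][R_x,Q]` and the summed
bounds `Σ ‖[S,S]‖ ≤ S`, `ΣΣ ‖[S,[S,S]]‖ ≤ S`, `‖S‖ ≤ S`. [cite: KLS1988JSP, eq. (13)] -/
private theorem sum_sum_norm_lie_lie_mul_le (n : ℕ) (a b b' d : Fin 3) (u v : Λ) :
    ∑ x : Λ, ∑ y : Λ, ‖⁅(siteSpin n x a : Op Λ (n + 1)),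
        ⁅siteSpin n u b * siteSpin n v b', siteSpin n y d⁆⁆‖ ≤ (n : ℝ) ^ 2 := by
  set P : Op Λ (n + 1) := siteSpin n u b
  set Q : Op Λ (n + 1) := siteSpin n v b'
  have hS : (0 : ℝ) ≤ (n : ℝ) / 2 := by positivity
  have key : ∀ x y : Λ, ‖⁅(siteSpin n x a : Op Λ (n + 1)), ⁅P * Q, siteSpin n y d⁆⁆‖ ≤
      ‖⁅(siteSpin n x a : Op Λ (n + 1)), P⁆‖ * ‖⁅Q, (siteSpin n y d : Op Λ (n + 1))⁆‖ +
        ‖P‖ * ‖⁅(siteSpin n x a : Op Λ (n + 1)), ⁅Q, siteSpin n y d⁆⁆‖ +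
        ‖⁅(siteSpin n x a : Op Λ (n + 1)), ⁅P, siteSpin n y d⁆⁆‖ * ‖Q‖ +
        ‖⁅P, (siteSpin n y d : Op Λ (n + 1))⁆‖ * ‖⁅(siteSpin n x a : Op Λ (n + 1)), Q⁆‖ := by
    intro x y
    rw [mx_lie_lie_mul]
    refine (norm_add_le _ _).trans (add_le_add ((norm_add_le _ _).trans (add_le_add
      ((norm_add_le _ _).trans (add_le_add (norm_mul_le _ _) (norm_mul_le _ _)))
      (norm_mul_le _ _))) (norm_mul_le _ _))
  refine (Finset.sum_le_sum fun x _ => Finset.sum_le_sum fun y _ => key x y).trans ?_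
  simp only [Finset.sum_add_distrib]
  have h1 : ∑ x : Λ, ∑ y : Λ, ‖⁅(siteSpin n x a : Op Λ (n + 1)), P⁆‖ *
      ‖⁅Q, (siteSpin n y d : Op Λ (n + 1))⁆‖ ≤ (n : ℝ) / 2 * ((n : ℝ) / 2) := by
    rw [← Finset.sum_mul_sum]
    exact mul_le_mul (sum_norm_lie_siteSpin_le n u a b) (sum_norm_lie_siteSpin_le' n v b' d)
      (Finset.sum_nonneg fun _ _ => norm_nonneg _) hS
  have h2 : ∑ x : Λ, ∑ y : Λ, ‖P‖ * ‖⁅(siteSpin n x a : Op Λ (n + 1)), ⁅Q, siteSpin n y d⁆⁆‖ ≤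
      (n : ℝ) / 2 * ((n : ℝ) / 2) := by
    simp_rw [← Finset.mul_sum]
    exact mul_le_mul (norm_siteSpin_le n u b) (sum_sum_norm_lie_lie_siteSpin_le n v a b' d)
      (Finset.sum_nonneg fun _ _ => Finset.sum_nonneg fun _ _ => norm_nonneg _) hS
  have h3 : ∑ x : Λ, ∑ y : Λ, ‖⁅(siteSpin n x a : Op Λ (n + 1)), ⁅P, siteSpin n y d⁆⁆‖ * ‖Q‖ ≤
      (n : ℝ) / 2 * ((n : ℝ) / 2) := by
    simp_rw [← Finset.sum_mul]
    exact mul_le_mul (sum_sum_norm_lie_lie_siteSpin_le n u a b d) (norm_siteSpin_le n v b')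
      (norm_nonneg _) hS
  have h4 : ∑ x : Λ, ∑ y : Λ, ‖⁅P, (siteSpin n y d : Op Λ (n + 1))⁆‖ *
      ‖⁅(siteSpin n x a : Op Λ (n + 1)), Q⁆‖ ≤ (n : ℝ) / 2 * ((n : ℝ) / 2) := by
    simp_rw [← Finset.sum_mul]
    rw [← Finset.mul_sum]
    exact mul_le_mul (sum_norm_lie_siteSpin_le' n u b d) (sum_norm_lie_siteSpin_le n v a b')
      (Finset.sum_nonneg fun _ _ => norm_nonneg _) hS
  have hring : (n : ℝ) / 2 * ((n : ℝ) / 2) * 4 = (n : ℝ) ^ 2 := by ring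
  linarith

/-- The symmetrised bond is the plain product, `spinBond β u v = S^β_u S^β_v`, for ALL `u, v`
(`S^β_u` and `S^β_v` commute: trivially for `u = v`, by locality otherwise). [folklore] -/
private theorem spinBond_eq_mul (n : ℕ) (β : Fin 3) (u v : Λ) :
    spinBond n β u v = siteSpin n u β * siteSpin n v β := by
  -- adapted from `spinBond_eq_mul_of_ne` (Literature/.../XYOrderInfraredProofs.lean)
  have hc : siteSpin n v β * siteSpin n u β = (siteSpin n u β * siteSpin n v β : Op Λ (n + 1)) := by
    by_cases huv : u = v
    · rw [huv]
    · exact (siteSpin_commute_of_ne_holds n huv β β).eq.symm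
  rw [spinBond, hc, ← two_smul ℂ, smul_smul]
  norm_num

/-- The same for a bond of the Hamiltonian: `Σ_x Σ_y ‖[S^a_x, [spinBond β u v, S^a_y]]‖ ≤ n²`.
[cite: KLS1988JSP, eq. (13)] -/
private theorem sum_sum_norm_lie_lie_spinBond_le (n : ℕ) (β a : Fin 3) (u v : Λ) :
    ∑ x : Λ, ∑ y : Λ, ‖⁅(siteSpin n x a : Op Λ (n + 1)), ⁅spinBond n β u v, siteSpin n y a⁆⁆‖ ≤
      (n : ℝ) ^ 2 := by
  rw [spinBond_eq_mul]
  exact sum_sum_norm_lie_lie_mul_le n a β β a u v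

end SpinAlgebra

/-! ### The stub -/

/-- **Double commutator with the XY Hamiltonian is `O(n²L²)` in every state** (stub
`stub_doubleCommutatorXY` of the line `feynman-sector-gap`). For the in-plane modes `A = Ŝ^α_q`
(`α = 0, 1`) of the spin-`n/2` torus `(ℤ/Lℤ)²`, `L ≥ 3`, and ANY Hermitian `H'` (whose tracial
ground state plays the role of an arbitrary state): `Re ω_{H'}([Aᴴ,[xyTorus 2 L n, A]]) ≤ 4 n² L²`.
`|Re ω'(D)| ≤ ‖D‖`; `D = -Σ_x Σ_b Σ_y conj(c_x) c_y [S^α_x,[h_b,S^α_y]]` with `|c| = 1`; per bond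
and component the double site sum is `≤ n²` BY THE su(2) RELATIONS and locality
(`sum_sum_norm_lie_lie_spinBond_le`; a naive norm bound would give `n⁴`); two components, `2L²`
bonds. KLS, J. Stat. Phys. 53 (1988), eq. (13) (the double-commutator / `f`-sum object).
[cite: KLS1988JSP, eq. (13)] -/
theorem stub_doubleCommutatorXY :
    ∃ K₀ : ℝ, 0 < K₀ ∧ ∀ (n L : ℕ) [NeZero L], 1 ≤ n → 3 ≤ L →
      ∀ (H' : Op (TorusSite 2 L) (n + 1)), H'.IsHermitian →
      ∀ (q : TorusSite 2 L) (α : Fin 3), α ≠ 2 →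
        (H'.groundStateFunctional (doubleComm (spinMode L n q α) (xyTorus 2 L n))).re ≤
          K₀ * (n : ℝ) ^ 2 * (L : ℝ) ^ 2 := by
  refine ⟨4, by norm_num, ?_⟩
  intro n L _ _hn hL H' hH' q α _hα
  have hL2 : 2 ≤ L := by omega
  have hL2' : L ≠ 2 := by omega
  -- the phases `c_x = e^{-ip·x}` and the bond terms `b_e` of the XY Hamiltonian
  set c : TorusSite 2 L → ℂ := fun x => cexp (-(I * (torusPhase L q x : ℂ))) with hc
  set E := (torusGraph 2 L).edgeFinset with hE
  set b : Sym2 (TorusSite 2 L) → Op (TorusSite 2 L) (n + 1) := Sym2.lift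
    ⟨fun u v => spinBond n 0 u v + spinBond n 1 u v + ((0 : ℝ) : ℂ) • spinBond n 2 u v,
      fun u v => by simp only [spinBond_comm]⟩
  have hc1 : ∀ x, ‖c x‖ = 1 := fun x => by simp [hc, Complex.norm_exp]
  -- cardinalities: `|Λ| = L²`, `#E = 2L²`
  have hcardT : (Fintype.card (TorusSite 2 L) : ℝ) = (L : ℝ) ^ 2 := by
    rw [Fintype.card_pi, prod_const, ZMod.card, card_univ, Fintype.card_fin]
    push_cast
    ring
  have hcardE : (E.card : ℝ) = 2 * (L : ℝ) ^ 2 := by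
    -- adapted from the landed sibling stub `stub_fourierBudget`
    have h5 := sum_pairs_eq_sum_edgeFinset (d := 2) L hL2 (fun _ => (1 : ℝ))
    simp only [sum_const, card_univ, nsmul_eq_mul, mul_one, Fintype.card_fin, if_neg hL2',
      one_mul] at h5
    rw [← hE] at h5
    rw [← hcardT]
    push_cast at h5 ⊢
    linarith
  -- the mode, its adjoint, the Hamiltonian
  have hA : spinMode L n q α = ∑ y : TorusSite 2 L, c y • siteSpin n y α := rfl
  have hAH : (spinMode L n q α)ᴴ = ∑ x : TorusSite 2 L, star (c x) • siteSpin n x α := by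
    rw [hA, conjTranspose_sum]
    refine sum_congr rfl fun x _ => ?_
    rw [conjTranspose_smul, (siteSpin_isHermitian n x α).eq]
  have hX : xyTorus 2 L n = ((-1 : ℝ) : ℂ) • ∑ e ∈ E, b e := rfl
  -- bilinear expansion of the double commutator
  have hXA : ⁅xyTorus 2 L n, spinMode L n q α⁆ = ∑ e ∈ E, ∑ y : TorusSite 2 L,
      (((-1 : ℝ) : ℂ) * c y) • ⁅b e, (siteSpin n y α : Op (TorusSite 2 L) (n + 1))⁆ := by
    rw [hX, hA, mx_smul_lie, mx_sum_lie, Finset.smul_sum]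
    refine sum_congr rfl fun e _ => ?_
    rw [mx_lie_sum, Finset.smul_sum]
    refine sum_congr rfl fun y _ => ?_
    rw [mx_lie_smul, smul_smul]
  have hD : doubleComm (spinMode L n q α) (xyTorus 2 L n) =
      ∑ x : TorusSite 2 L, ∑ e ∈ E, ∑ y : TorusSite 2 L, (star (c x) * (((-1 : ℝ) : ℂ) * c y)) •
        ⁅(siteSpin n x α : Op (TorusSite 2 L) (n + 1)), ⁅b e, siteSpin n y α⁆⁆ := by
    show ⁅(spinMode L n q α)ᴴ, ⁅xyTorus 2 L n, spinMode L n q α⁆⁆ = _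
    rw [hXA, hAH, mx_sum_lie]
    refine sum_congr rfl fun x _ => ?_
    rw [mx_smul_lie, mx_lie_sum, Finset.smul_sum]
    refine sum_congr rfl fun e _ => ?_
    rw [mx_lie_sum, Finset.smul_sum]
    refine sum_congr rfl fun y _ => ?_
    rw [mx_lie_smul, smul_smul]
  -- the bond estimate: two in-plane components, `n²` each
  have hbond : ∀ e : Sym2 (TorusSite 2 L), ∑ x : TorusSite 2 L, ∑ y : TorusSite 2 L,
      ‖⁅(siteSpin n x α : Op (TorusSite 2 L) (n + 1)), ⁅b e, siteSpin n y α⁆⁆‖ ≤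
        2 * (n : ℝ) ^ 2 := by
    intro e
    induction e using Sym2.ind with
    | h u v =>
      have hbe : b s(u, v) = spinBond n 0 u v + spinBond n 1 u v := by
        have h0 : b s(u, v) =
            spinBond n 0 u v + spinBond n 1 u v + ((0 : ℝ) : ℂ) • spinBond n 2 u v := rfl
        rw [h0, Complex.ofReal_zero, zero_smul, add_zero]
      calc ∑ x : TorusSite 2 L, ∑ y : TorusSite 2 L,
            ‖⁅(siteSpin n x α : Op (TorusSite 2 L) (n + 1)), ⁅b s(u, v), siteSpin n y α⁆⁆‖
          ≤ ∑ x : TorusSite 2 L, ∑ y : TorusSite 2 L,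
              (‖⁅(siteSpin n x α : Op (TorusSite 2 L) (n + 1)),
                  ⁅spinBond n 0 u v, siteSpin n y α⁆⁆‖ +
                ‖⁅(siteSpin n x α : Op (TorusSite 2 L) (n + 1)),
                  ⁅spinBond n 1 u v, siteSpin n y α⁆⁆‖) := by
            refine sum_le_sum fun x _ => sum_le_sum fun y _ => ?_
            rw [hbe, mx_add_lie, mx_lie_add]
            exact norm_add_le _ _
        _ ≤ (n : ℝ) ^ 2 + (n : ℝ) ^ 2 := by
            simp only [Finset.sum_add_distrib]
            exact add_le_add (sum_sum_norm_lie_lie_spinBond_le n 0 α u v)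
              (sum_sum_norm_lie_lie_spinBond_le n 1 α u v)
        _ = 2 * (n : ℝ) ^ 2 := by ring
  -- the operator norm of the double commutator
  have hnormD :
      ‖doubleComm (spinMode L n q α) (xyTorus 2 L n)‖ ≤ 4 * (n : ℝ) ^ 2 * (L : ℝ) ^ 2 := by
    rw [hD]
    have hs : ∀ x y, ‖star (c x) * (((-1 : ℝ) : ℂ) * c y)‖ = 1 := by
      intro x y
      rw [norm_mul, norm_mul, norm_star, hc1, hc1]
      simp
    refine (norm_sum_le _ _).trans ?_
    refine (Finset.sum_le_sum fun x _ => (norm_sum_le _ _).trans <|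
      Finset.sum_le_sum fun e _ => norm_sum_le _ _).trans ?_
    simp only [norm_smul, hs, one_mul]
    rw [Finset.sum_comm]
    calc ∑ e ∈ E, ∑ x : TorusSite 2 L, ∑ y : TorusSite 2 L,
          ‖⁅(siteSpin n x α : Op (TorusSite 2 L) (n + 1)), ⁅b e, siteSpin n y α⁆⁆‖
        ≤ ∑ _e ∈ E, 2 * (n : ℝ) ^ 2 := sum_le_sum fun e _ => hbond e
      _ = 4 * (n : ℝ) ^ 2 * (L : ℝ) ^ 2 := by
          rw [sum_const, nsmul_eq_mul, hcardE]
          ring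
  -- the state: `Re ω'(D) ≤ |Re ω'(D)| ≤ ‖D‖`
  exact (le_abs_self _).trans ((abs_re_groundStateFunctional_le_norm hH' _).trans hnormD)

end Summit.HubbardSuperconductivity.HubbardSuperconductivity.Theorems.XYOrderOpennessLargeSpin

end
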